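import Summits.BirchSwinnertonDyer.BirchSwinnertonDyer.Theorems.KimAtThreeShallowEqDeepOffStratumSockets
import Summits.BirchSwinnertonDyer.BirchSwinnertonDyer.Theorems.KimAtThreeDeepLowerNonAdditiveRows
import Summits.BirchSwinnertonDyer.Rank1Residual.X4.OptimalPeriod
import Literature.NumberTheory.EllipticCurves.ManinConstantSemistablePrimewise
import Literature.NumberTheory.EllipticCurves.BSDRootNumberLocalTablesProofs
import Literature.NumberTheory.EllipticCurves.RootNumberProofs
import HarnessLib

/-!
# Route `KimAtThreeKolyvagin` (rung W2), crux `ShallowEqDeepOffKatoStratum` (item 19599) on its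
# NON-ADDITIVE tower rows at `p = 3`, BY NAME: good ordinary `3` (Yan–Zhu 2026) and multiplicative `3`
# with (ram) (Skinner 2016) — the crux ⟸ its upper twin, outright when `3 ∤ ∏ c_ℓ`, modulo «TamDiv∞» else

Cell `bsd-addord`, seat `bsd-addord-w2-c4` (gen 5), item `stmt-BirchSwinnertonDyer-19599`, stub
`stub_nonAdditive` (good incl. anomalous / multiplicative `3`; `3`-adic tower onto, `E(ℚ₃)[3] = 0`, `Ш`
finite, optimal datum `D₀` at `N = N_E`, analytic rank `0`). The row sockets of
`KimAtThreeShallowEqDeepOffStratumSockets` (notation `a, s, c, d, ∂` there) specialised to the crux's own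
currency:

* §1 `¬ Addv W₀ 3` ⟹ `9 ∤ N_E` (Silverman *ATAEC* IV.10.2 (c), tree `natGenerator_sq_dvd_conductorNorm_iff`)
  ⟹ `3 ∤ c_{D₀}` for the optimal datum (Mazur 1978 Cor. 4.1 BY NAME, `mazur_not_dvd_maninConstant_of_odd`)
  ⟹ the `3`-adic period transfer `Ω(W₀) = u·Ω⁺_{D₀.f}`, `|u|₃ = 1` (`X4.periodTransfer_of_optimal`) — the
  `hper` binder of every BSD-currency socket is DISCHARGED on the non-additive rows.
* §2 GOOD ORDINARY rows (row C16: Yan–Zhu 2026 Thm. 4.15 `hYZ` [PUB*, flag `YZ26@3-BF-ERL-Ohta`], Wuthrich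
  2014 L20 `hW20`, modularity `hmod`, GZK `hGZK` ⟹ `BSDp W₀ 3`) and MULTIPLICATIVE rows with Skinner's
  (ram) witness (row C1: Skinner 2016 Thm. C `hSk`): the upper twin (crux 19562's ROW conclusion,
  displayed) gives crux 19599 at the row OUTRIGHT when `3 ∤ ∏ c_ℓ` and modulo TamDiv∞
  (`v₃(∏ c_ℓ) ≤ ∂^{(∞)}(δ̃)`: `3^{v₃(∏ c_ℓ)}` divides every cyclic-level Kurihara number; Kim 2022 Conj. 1.10
  `≥` half) otherwise; and crux 19599 ∧ the lower twin (crux 19679's ROW conclusion) ⟹ TamDiv∞ — the typed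
  obstruction is NECESSARY given the twins (model: w2-c2's `KimAtThreeDeepLowerNonAdditiveRows`).

HONEST FRAMING. Theorems only; every printed input is a hypothesis BY NAME; the sibling cruxes enter only
as displayed row conclusions; nothing asserted, nothing booked; crux 19599 stays OPEN — at `p = 3` no
admissible published input gives it on any non-additive row (Kim AJM 148 Thm. 1.9 is `p ≥ 5`; Kim 2025 is
announced). NOT covered: good supersingular `3` (corners X6/X8) and multiplicative `3` without (ram)
(X11a at `3`) — no `BSD(E,3)` in the tree; there only the `BSD_p`-free sockets of the companion file apply.

References: [YanZhu2024MainConjNonCM] Thm. 4.15; [Wuthrich2014] Lemma 20; [Skinner2016PacificMC] Thm. C;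
[Mazur1978] Cor. 4.1; [Miller2011LMS] Def. 1.1; [Kim2022StructureSelmer] Conj. 1.10, Thm. 1.9 (6);
[Kim2025RefinedTNC] Thm. 1.2; [CremonaAlgorithms1997] §2.8; [Silverman1994] IV.10.2.
-/

set_option autoImplicit false
-- the Theorems namespace of a single-conjunct summit repeats the summit name by design (D-0017)
set_option linter.dupNamespace false

noncomputable section

open scoped MatrixGroups ModularForm Classical

open CongruenceSubgroup WeierstrassCurve IsDedekindDomain Literature.NumberTheory.EllipticCurves
  Literature.NumberTheory.EllipticCurves.ModularForms
  Literature.NumberTheory.EllipticCurves.Rank1Residual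
  Literature.NumberTheory.EllipticCurves.Rank1Residual.Typed

namespace Summit.BirchSwinnertonDyer.BirchSwinnertonDyer.Theorems.KimAtThreeShallowEqDeepOffStratumNonAdditiveRows

open Summit.BirchSwinnertonDyer.Rank1Residual
open Summit.BirchSwinnertonDyer.Rank1Residual.X4
open Summit.BirchSwinnertonDyer.BirchSwinnertonDyer.Theses.KimAtThreeKolyvagin
open Summit.BirchSwinnertonDyer.BirchSwinnertonDyer.Theorems.KimAtThreeKolyvaginUnitLevelOneRungs
open Summit.BirchSwinnertonDyer.BirchSwinnertonDyer.Theorems.KimAtThreeDeepLowerNonAdditiveRows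
open Summit.BirchSwinnertonDyer.BirchSwinnertonDyer.Theorems.KimAtThreeShallowEqDeepOffStratumSockets


/-! ### §1 `p = 3`, the crux's currency: optimal datum at the conductor on a NON-ADDITIVE tower row -/

section OptimalDatum

variable (W₀ : WeierstrassCurve ℚ) [W₀.IsElliptic] [W₀.IsGloballyMinimal]

omit [W₀.IsGloballyMinimal] in
/-- **`¬ Addv W₀ 3 ⟹ 9 ∤ N_E`**: a non-additive prime is good or multiplicative, and `p² ∣ N_E` iff the
reduction at the place over `p` is additive (Silverman *ATAEC* IV.10.2 (c); tree
`natGenerator_sq_dvd_conductorNorm_iff`). [cite: Silverman1994, IV.10.2(c)] -/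
theorem not_sq_dvd_conductorNorm_of_not_addv
    (h : ¬ (haveI : Fact (Nat.Prime 3) := ⟨Nat.prime_three⟩; Addv W₀ 3)) :
    ¬ 3 ^ 2 ∣ W₀.conductorNorm ℤ := by
  haveI : Fact (Nat.Prime 3) := ⟨Nat.prime_three⟩
  set P : Nat.Primes := ⟨3, Nat.prime_three⟩ with hP
  set v : HeightOneSpectrum ℤ := (Rat.HeightOneSpectrum.primesEquiv (R := ℤ)).symm P with hv
  have hgen : Rat.HeightOneSpectrum.natGenerator v = 3 :=
    congrArg Subtype.val ((Rat.HeightOneSpectrum.primesEquiv (R := ℤ)).apply_symm_apply P)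
  have hna : ¬ W₀.HasAdditiveReductionAt v := by
    unfold Addv at h
    by_cases hg : W₀.HasGoodReductionAtPrime 3
    · exact ((W₀.hasGoodReductionAtPrime_iff_hasGoodReductionAt_holds P).mp hg).not_hasAdditiveReductionAt
    · have hm : W₀.HasMultiplicativeReductionAtPrime 3 := by
        by_contra hm
        exact h ⟨hg, hm⟩
      exact ((W₀.hasMultiplicativeReductionAtPrime_iff_hasMultiplicativeReductionAt_holds P).mp
        hm).not_hasAdditiveReductionAt
  intro h9
  rw [← hgen] at h9
  exact hna ((natGenerator_sq_dvd_conductorNorm_iff v W₀).mp h9)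

/-- **On a non-additive row the optimal datum at the conductor has `3 ∤ c_{D₀}`** — Mazur 1978 Cor. 4.1
BY NAME (`hMaz`: odd `p` with `p² ∤ N` does not divide the Manin constant of an optimal datum), since
`9 ∤ N_E`. [cite: Mazur1978, Cor. 4.1] -/
theorem not_three_dvd_maninConstant_of_not_addv (hMaz : mazur_not_dvd_maninConstant_of_odd)
    {N : ℕ} [NeZero N] (hN : N = W₀.conductorNorm ℤ) (D₀ : ModularParametrizationData W₀ N)
    (hopt : ∀ z ∈ D₀.L.lattice, ∃ w ∈ periodLattice D₀.f, z = D₀.c * w)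
    (h : ¬ (haveI : Fact (Nat.Prime 3) := ⟨Nat.prime_three⟩; Addv W₀ 3)) :
    ¬ (3 : ℤ) ∣ D₀.maninConstant :=
  hMaz W₀ D₀ hopt 3 Nat.prime_three (by norm_num)
    (hN ▸ not_sq_dvd_conductorNorm_of_not_addv W₀ h)

/-- **… hence the `3`-adic period transfer `Ω(W₀) = u·Ω⁺_{D₀.f}`, `|u|₃ = 1`** (`u = |c_{D₀}|`,
`X4.periodTransfer_of_optimal`). [cite: CremonaAlgorithms1997, §2.8 (p. 26)] [cite: Mazur1978, Cor. 4.1] -/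
theorem periodTransfer_three_of_optimal_of_not_addv (hMaz : mazur_not_dvd_maninConstant_of_odd)
    {N : ℕ} [NeZero N] (hN : N = W₀.conductorNorm ℤ) (D₀ : ModularParametrizationData W₀ N)
    (hopt : ∀ z ∈ D₀.L.lattice, ∃ w ∈ periodLattice D₀.f, z = D₀.c * w)
    (h : ¬ (haveI : Fact (Nat.Prime 3) := ⟨Nat.prime_three⟩; Addv W₀ 3)) :
    ∃ u : ℚ, ‖(u : ℚ_[3])‖ = 1 ∧ W₀.realPeriodRat = u * plusPeriod D₀.f :=
  haveI : Fact (Nat.Prime 3) := ⟨Nat.prime_three⟩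
  periodTransfer_of_optimal 3 D₀ hopt (not_three_dvd_maninConstant_of_not_addv W₀ hMaz hN D₀ hopt h)

end OptimalDatum

/-! ### §2 The by-name rows at `p = 3` (binders of `stub_nonAdditive` verbatim, then the row data) -/

/-- **Crux 19599 on the GOOD-ORDINARY tower rows, from the upper twin (crux 19562 at the row) and
TamDiv∞** — binders of `stub_nonAdditive` verbatim, then: good ordinary reduction at `3`, 19562's ROW
conclusion `s + d ≤ a` (displayed), `v₃(∏ c_ℓ) ≤ ∂^{(∞)}(δ̃)` (displayed); named facts Yan–Zhu 2026 Thm. 4.15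
(`hYZ`), Wuthrich 2014 L20 (`hW20`), modularity (`hmod`), GZK (`hGZK`), Mazur Cor. 4.1 (`hMaz`). Route:
row C16 ⟹ `BSDp W₀ 3` ⟹ Miller's lower half ⟹ the `BSD_p` socket of `KimAtThreeShallowEqDeepOffStratumSockets`. [cite: YanZhu2024MainConjNonCM, Thm. 4.15 (§4.6)]
[cite: Wuthrich2014, Lemma 20 (p. 399)] [cite: Mazur1978, Cor. 4.1] [cite: Kim2022StructureSelmer, Conj. 1.10 (PDF p. 8)] -/
theorem shallowEqDeepOff_row_goodOrd_of_yanZhu_of_upperRow_of_tamagawa_le_partialInfty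
    (hYZ : YanZhu2026.thm415_padicValRat_bsd_rank_le_one)
    (hW20 : Wuthrich2014.lemma20_surjective_threeAdic_of_semistable)
    (hmod : hasEntireLFunction_rat) (hGZK : rank_eq_analyticRank_of_analyticRank_le_one)
    (hMaz : mazur_not_dvd_maninConstant_of_odd) :
    ∀ (W₀ : WeierstrassCurve ℚ) [W₀.IsElliptic] [W₀.IsGloballyMinimal],
      (∀ n : ℕ, W₀.HasSurjectiveModNGaloisRep (3 ^ n : ℕ)) →
      Nat.card {Q : (W₀.baseChange ℚ_[3]).toAffine.Point // (3 : ℕ) • Q = 0} = 1 → Finite W₀.sha →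
      ∀ {N : ℕ} [NeZero N], N = W₀.conductorNorm ℤ → ∀ (D₀ : ModularParametrizationData W₀ N),
        (∀ z ∈ D₀.L.lattice, ∃ w ∈ periodLattice D₀.f, z = D₀.c * w) →
        (∀ (W₂ : WeierstrassCurve ℚ) [W₂.IsElliptic] (D₂ : ModularParametrizationData W₂ N),
          D₂.f = D₀.f → D₀.modularDegree ≤ D₂.modularDegree) →
        (∀ r : ℚ, ratPlusSymbol D₀.f r ≠ 0 → 0 ≤ padicValRat 3 (ratPlusSymbol D₀.f r)) →
        kuriharaVanishingOrder W₀ 3 D₀.f = 0 →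
        W₀.HasGoodReductionAtPrime 3 → ¬ (3 : ℤ) ∣ W₀.frobeniusTrace 3 →
        (∃ d : ℕ, kuriharaPartialDeepInfty W₀ 3 D₀.f = d ∧
          ((padicValNat 3 (Nat.card (AddCommGroup.primaryComponent W₀.sha 3)) + d : ℕ) : ℕ∞) ≤
            kuriharaPartial W₀ 3 D₀.f 0) →
        ((padicValNat 3 W₀.tamagawaProduct : ℕ) : ℕ∞) ≤ kuriharaPartialInfty W₀ 3 D₀.f →
        kuriharaPartialDeepInfty W₀ 3 D₀.f ≤ kuriharaPartialInfty W₀ 3 D₀.f := by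
  intro W₀ _ _ htow _ hfin N _ hN D₀ hopt _ _ hord hgood hord3 hU htam
  haveI : Fact (Nat.Prime 3) := ⟨Nat.prime_three⟩
  haveI : Finite W₀.sha := hfin
  have hsurj : Surj W₀ 3 := by
    have h := htow 1
    rw [pow_one] at h
    exact h
  have hirr : Irr W₀ 3 := hasIrreducibleModPGaloisRep_of_hasSurjectiveModNGaloisRep W₀ 3 hsurj
  have hr0 := analyticRank_eq_zero_of_kuriharaVanishingOrder_eq_zero W₀ D₀.f D₀.isNewformOf hord
  have hC16 : RowC16 W₀ 3 := ⟨rfl, ⟨hgood, by exact_mod_cast hord3⟩, hirr, Or.inl hsurj⟩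
  have hbsd : BSDp W₀ 3 := RowC16.bsdp hYZ hW20 hmod hGZK (by rw [hr0]; exact zero_le_one) hC16
  have hna : ¬ Addv W₀ 3 := fun h => h.1 hgood
  exact shallowEqDeep_conclusion_of_upperRow_of_missingLowerBoundAt_of_tamagawa_le_partialInfty W₀ 3
    D₀.f hGZK (by norm_num) hirr D₀.isNewformOf hord
    (periodTransfer_three_of_optimal_of_not_addv W₀ hMaz hN D₀ hopt hna)
    (lower_and_upper_of_missingPPartAt W₀ 3 (missingPPartAt_of_bsdp W₀ 3 hbsd)).1 hU htam

/-- **… OUTRIGHT (upper twin alone) on the good-ordinary tower rows with `3 ∤ ∏ c_ℓ`.**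
[cite: YanZhu2024MainConjNonCM, Thm. 4.15 (§4.6)] [cite: Wuthrich2014, Lemma 20 (p. 399)] [cite: Mazur1978, Cor. 4.1] -/
theorem shallowEqDeepOff_row_goodOrd_of_yanZhu_of_upperRow_of_not_three_dvd_tamagawa
    (hYZ : YanZhu2026.thm415_padicValRat_bsd_rank_le_one)
    (hW20 : Wuthrich2014.lemma20_surjective_threeAdic_of_semistable)
    (hmod : hasEntireLFunction_rat) (hGZK : rank_eq_analyticRank_of_analyticRank_le_one)
    (hMaz : mazur_not_dvd_maninConstant_of_odd) :
    ∀ (W₀ : WeierstrassCurve ℚ) [W₀.IsElliptic] [W₀.IsGloballyMinimal],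
      (∀ n : ℕ, W₀.HasSurjectiveModNGaloisRep (3 ^ n : ℕ)) →
      Nat.card {Q : (W₀.baseChange ℚ_[3]).toAffine.Point // (3 : ℕ) • Q = 0} = 1 → Finite W₀.sha →
      ∀ {N : ℕ} [NeZero N], N = W₀.conductorNorm ℤ → ∀ (D₀ : ModularParametrizationData W₀ N),
        (∀ z ∈ D₀.L.lattice, ∃ w ∈ periodLattice D₀.f, z = D₀.c * w) →
        (∀ (W₂ : WeierstrassCurve ℚ) [W₂.IsElliptic] (D₂ : ModularParametrizationData W₂ N),
          D₂.f = D₀.f → D₀.modularDegree ≤ D₂.modularDegree) →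
        (∀ r : ℚ, ratPlusSymbol D₀.f r ≠ 0 → 0 ≤ padicValRat 3 (ratPlusSymbol D₀.f r)) →
        kuriharaVanishingOrder W₀ 3 D₀.f = 0 →
        W₀.HasGoodReductionAtPrime 3 → ¬ (3 : ℤ) ∣ W₀.frobeniusTrace 3 →
        (∃ d : ℕ, kuriharaPartialDeepInfty W₀ 3 D₀.f = d ∧
          ((padicValNat 3 (Nat.card (AddCommGroup.primaryComponent W₀.sha 3)) + d : ℕ) : ℕ∞) ≤
            kuriharaPartial W₀ 3 D₀.f 0) →
        ¬ 3 ∣ W₀.tamagawaProduct →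
        kuriharaPartialDeepInfty W₀ 3 D₀.f ≤ kuriharaPartialInfty W₀ 3 D₀.f := by
  intro W₀ _ _ htow ht hfin N _ hN D₀ hopt hdeg hint hord hgood hord3 hU htam
  refine shallowEqDeepOff_row_goodOrd_of_yanZhu_of_upperRow_of_tamagawa_le_partialInfty hYZ hW20 hmod
    hGZK hMaz W₀ htow ht hfin hN D₀ hopt hdeg hint hord hgood hord3 hU ?_
  rw [padicValNat.eq_zero_of_not_dvd htam, Nat.cast_zero]
  exact zero_le

/-- **Necessity on the good-ordinary tower rows: crux 19599 at the row ∧ the lower twin (crux 19679 at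
the row) ⟹ TamDiv∞** (`BSDp W₀ 3` by name gives Miller's upper half). [cite: YanZhu2024MainConjNonCM, Thm. 4.15 (§4.6)]
[cite: Kim2022StructureSelmer, Conj. 1.10 (PDF p. 8)] [cite: Mazur1978, Cor. 4.1] -/
theorem tamagawa_le_partialInfty_row_goodOrd_of_yanZhu_of_lowerRow_of_shallowEqDeepOff
    (hYZ : YanZhu2026.thm415_padicValRat_bsd_rank_le_one)
    (hW20 : Wuthrich2014.lemma20_surjective_threeAdic_of_semistable)
    (hmod : hasEntireLFunction_rat) (hGZK : rank_eq_analyticRank_of_analyticRank_le_one)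
    (hMaz : mazur_not_dvd_maninConstant_of_odd) :
    ∀ (W₀ : WeierstrassCurve ℚ) [W₀.IsElliptic] [W₀.IsGloballyMinimal],
      (∀ n : ℕ, W₀.HasSurjectiveModNGaloisRep (3 ^ n : ℕ)) →
      Nat.card {Q : (W₀.baseChange ℚ_[3]).toAffine.Point // (3 : ℕ) • Q = 0} = 1 → Finite W₀.sha →
      ∀ {N : ℕ} [NeZero N], N = W₀.conductorNorm ℤ → ∀ (D₀ : ModularParametrizationData W₀ N),
        (∀ z ∈ D₀.L.lattice, ∃ w ∈ periodLattice D₀.f, z = D₀.c * w) →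
        (∀ (W₂ : WeierstrassCurve ℚ) [W₂.IsElliptic] (D₂ : ModularParametrizationData W₂ N),
          D₂.f = D₀.f → D₀.modularDegree ≤ D₂.modularDegree) →
        (∀ r : ℚ, ratPlusSymbol D₀.f r ≠ 0 → 0 ≤ padicValRat 3 (ratPlusSymbol D₀.f r)) →
        kuriharaVanishingOrder W₀ 3 D₀.f = 0 →
        W₀.HasGoodReductionAtPrime 3 → ¬ (3 : ℤ) ∣ W₀.frobeniusTrace 3 →
        (∃ d : ℕ, kuriharaPartialDeepInfty W₀ 3 D₀.f = d ∧
          kuriharaPartial W₀ 3 D₀.f 0 ≤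
            ((padicValNat 3 (Nat.card (AddCommGroup.primaryComponent W₀.sha 3)) + d : ℕ) : ℕ∞)) →
        kuriharaPartialDeepInfty W₀ 3 D₀.f ≤ kuriharaPartialInfty W₀ 3 D₀.f →
        ((padicValNat 3 W₀.tamagawaProduct : ℕ) : ℕ∞) ≤ kuriharaPartialInfty W₀ 3 D₀.f := by
  intro W₀ _ _ htow _ hfin N _ hN D₀ hopt _ _ hord hgood hord3 hL hS
  haveI : Fact (Nat.Prime 3) := ⟨Nat.prime_three⟩
  haveI : Finite W₀.sha := hfin
  have hsurj : Surj W₀ 3 := by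
    have h := htow 1
    rw [pow_one] at h
    exact h
  have hirr : Irr W₀ 3 := hasIrreducibleModPGaloisRep_of_hasSurjectiveModNGaloisRep W₀ 3 hsurj
  have hr0 := analyticRank_eq_zero_of_kuriharaVanishingOrder_eq_zero W₀ D₀.f D₀.isNewformOf hord
  have hC16 : RowC16 W₀ 3 := ⟨rfl, ⟨hgood, by exact_mod_cast hord3⟩, hirr, Or.inl hsurj⟩
  have hbsd : BSDp W₀ 3 := RowC16.bsdp hYZ hW20 hmod hGZK (by rw [hr0]; exact zero_le_one) hC16
  have hna : ¬ Addv W₀ 3 := fun h => h.1 hgood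
  exact tamagawa_le_partialInfty_of_lowerRow_of_missingUpperBoundAt_of_shallowEqDeep_conclusion W₀ 3
    D₀.f hGZK (by norm_num) hirr D₀.isNewformOf hord
    (periodTransfer_three_of_optimal_of_not_addv W₀ hMaz hN D₀ hopt hna)
    (lower_and_upper_of_missingPPartAt W₀ 3 (missingPPartAt_of_bsdp W₀ 3 hbsd)).2 hL hS

/-- **Crux 19599 on the MULTIPLICATIVE tower rows with Skinner's (ram) witness, from the upper twin and
TamDiv∞** — binders of `stub_nonAdditive` verbatim, then: multiplicative `3`, `Ram W₀ 3`, 19562's ROW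
conclusion, TamDiv∞; named facts Skinner 2016 Thm. C (`hSk`), `hmod`, `hGZK`, `hMaz` (row C1 ⟹
`BSDp W₀ 3`). [cite: Skinner2016PacificMC, Thm. C (§1)] [cite: Mazur1978, Cor. 4.1] [cite: Kim2022StructureSelmer, Conj. 1.10 (PDF p. 8)] -/
theorem shallowEqDeepOff_row_mult_of_skinner_of_upperRow_of_tamagawa_le_partialInfty
    (hSk : Skinner2016.thmC_padicValRat_bsd_rank_zero)
    (hmod : hasEntireLFunction_rat) (hGZK : rank_eq_analyticRank_of_analyticRank_le_one)
    (hMaz : mazur_not_dvd_maninConstant_of_odd) :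
    ∀ (W₀ : WeierstrassCurve ℚ) [W₀.IsElliptic] [W₀.IsGloballyMinimal],
      (∀ n : ℕ, W₀.HasSurjectiveModNGaloisRep (3 ^ n : ℕ)) →
      Nat.card {Q : (W₀.baseChange ℚ_[3]).toAffine.Point // (3 : ℕ) • Q = 0} = 1 → Finite W₀.sha →
      ∀ {N : ℕ} [NeZero N], N = W₀.conductorNorm ℤ → ∀ (D₀ : ModularParametrizationData W₀ N),
        (∀ z ∈ D₀.L.lattice, ∃ w ∈ periodLattice D₀.f, z = D₀.c * w) →
        (∀ (W₂ : WeierstrassCurve ℚ) [W₂.IsElliptic] (D₂ : ModularParametrizationData W₂ N),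
          D₂.f = D₀.f → D₀.modularDegree ≤ D₂.modularDegree) →
        (∀ r : ℚ, ratPlusSymbol D₀.f r ≠ 0 → 0 ≤ padicValRat 3 (ratPlusSymbol D₀.f r)) →
        kuriharaVanishingOrder W₀ 3 D₀.f = 0 →
        W₀.HasMultiplicativeReductionAtPrime 3 →
        (haveI : Fact (Nat.Prime 3) := ⟨Nat.prime_three⟩; Ram W₀ 3) →
        (∃ d : ℕ, kuriharaPartialDeepInfty W₀ 3 D₀.f = d ∧
          ((padicValNat 3 (Nat.card (AddCommGroup.primaryComponent W₀.sha 3)) + d : ℕ) : ℕ∞) ≤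
            kuriharaPartial W₀ 3 D₀.f 0) →
        ((padicValNat 3 W₀.tamagawaProduct : ℕ) : ℕ∞) ≤ kuriharaPartialInfty W₀ 3 D₀.f →
        kuriharaPartialDeepInfty W₀ 3 D₀.f ≤ kuriharaPartialInfty W₀ 3 D₀.f := by
  intro W₀ _ _ htow _ hfin N _ hN D₀ hopt _ _ hord hmult hram hU htam
  haveI : Fact (Nat.Prime 3) := ⟨Nat.prime_three⟩
  haveI : Finite W₀.sha := hfin
  have hsurj : Surj W₀ 3 := by
    have h := htow 1
    rw [pow_one] at h
    exact h
  have hirr : Irr W₀ 3 := hasIrreducibleModPGaloisRep_of_hasSurjectiveModNGaloisRep W₀ 3 hsurj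
  have hr0 := analyticRank_eq_zero_of_kuriharaVanishingOrder_eq_zero W₀ D₀.f D₀.isNewformOf hord
  have hC1 : RowC1 W₀ 3 := ⟨hr0, le_rfl, Or.inr hmult, hirr, hram⟩
  have hbsd : BSDp W₀ 3 := RowC1.bsdp hSk hmod hGZK hC1
  have hna : ¬ Addv W₀ 3 := fun h => h.2 hmult
  exact shallowEqDeep_conclusion_of_upperRow_of_missingLowerBoundAt_of_tamagawa_le_partialInfty W₀ 3
    D₀.f hGZK (by norm_num) hirr D₀.isNewformOf hord
    (periodTransfer_three_of_optimal_of_not_addv W₀ hMaz hN D₀ hopt hna)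
    (lower_and_upper_of_missingPPartAt W₀ 3 (missingPPartAt_of_bsdp W₀ 3 hbsd)).1 hU htam

/-- **… OUTRIGHT (upper twin alone) on the multiplicative (ram) tower rows with `3 ∤ ∏ c_ℓ`.**
[cite: Skinner2016PacificMC, Thm. C (§1)] [cite: Mazur1978, Cor. 4.1] -/
theorem shallowEqDeepOff_row_mult_of_skinner_of_upperRow_of_not_three_dvd_tamagawa
    (hSk : Skinner2016.thmC_padicValRat_bsd_rank_zero)
    (hmod : hasEntireLFunction_rat) (hGZK : rank_eq_analyticRank_of_analyticRank_le_one)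
    (hMaz : mazur_not_dvd_maninConstant_of_odd) :
    ∀ (W₀ : WeierstrassCurve ℚ) [W₀.IsElliptic] [W₀.IsGloballyMinimal],
      (∀ n : ℕ, W₀.HasSurjectiveModNGaloisRep (3 ^ n : ℕ)) →
      Nat.card {Q : (W₀.baseChange ℚ_[3]).toAffine.Point // (3 : ℕ) • Q = 0} = 1 → Finite W₀.sha →
      ∀ {N : ℕ} [NeZero N], N = W₀.conductorNorm ℤ → ∀ (D₀ : ModularParametrizationData W₀ N),
        (∀ z ∈ D₀.L.lattice, ∃ w ∈ periodLattice D₀.f, z = D₀.c * w) →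
        (∀ (W₂ : WeierstrassCurve ℚ) [W₂.IsElliptic] (D₂ : ModularParametrizationData W₂ N),
          D₂.f = D₀.f → D₀.modularDegree ≤ D₂.modularDegree) →
        (∀ r : ℚ, ratPlusSymbol D₀.f r ≠ 0 → 0 ≤ padicValRat 3 (ratPlusSymbol D₀.f r)) →
        kuriharaVanishingOrder W₀ 3 D₀.f = 0 →
        W₀.HasMultiplicativeReductionAtPrime 3 →
        (haveI : Fact (Nat.Prime 3) := ⟨Nat.prime_three⟩; Ram W₀ 3) →
        (∃ d : ℕ, kuriharaPartialDeepInfty W₀ 3 D₀.f = d ∧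
          ((padicValNat 3 (Nat.card (AddCommGroup.primaryComponent W₀.sha 3)) + d : ℕ) : ℕ∞) ≤
            kuriharaPartial W₀ 3 D₀.f 0) →
        ¬ 3 ∣ W₀.tamagawaProduct →
        kuriharaPartialDeepInfty W₀ 3 D₀.f ≤ kuriharaPartialInfty W₀ 3 D₀.f := by
  intro W₀ _ _ htow ht hfin N _ hN D₀ hopt hdeg hint hord hmult hram hU htam
  refine shallowEqDeepOff_row_mult_of_skinner_of_upperRow_of_tamagawa_le_partialInfty hSk hmod hGZK hMaz
    W₀ htow ht hfin hN D₀ hopt hdeg hint hord hmult hram hU ?_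
  rw [padicValNat.eq_zero_of_not_dvd htam, Nat.cast_zero]
  exact zero_le


end Summit.BirchSwinnertonDyer.BirchSwinnertonDyer.Theorems.KimAtThreeShallowEqDeepOffStratumNonAdditiveRows

end
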